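import Summits.BirchSwinnertonDyer.Rank1Residual.Additive.StrictSignedSelmerLayerZero
import Summits.BirchSwinnertonDyer.Rank1Residual.Additive.QuadraticBranchOddStrictSelmerReadings
import Summits.BirchSwinnertonDyer.Rank1Residual.Additive.QuadraticBranchOddStrictSelmerCertificate
import Summits.BirchSwinnertonDyer.Rank1Residual.Additive.StrictSelmerDominatesSha
import Summits.BirchSwinnertonDyer.Rank1Residual.GaloisImage.JWitnessTowerSurjectivity
import Summits.BirchSwinnertonDyer.Rank1Residual.GaloisImage.AbelianExtensionTorsionFields
import Literature.NumberTheory.EllipticCurves.NonEisensteinPrimeOfSurjective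
import Literature.NumberTheory.EllipticCurves.KatoRankBoundProofs
import HarnessLib

/-!
# `QuadraticBranchOddStrictSelmerBoundAt W p` as a KERNEL THEOREM modulo two READINGS of printed
# theorems (Kobayashi 2003 Thm. 4.1 odd-`η`; Kitajima–Otsuki 2018 sign `−`) on the strict-minus
# Selmer structure (cell `b2b-bsdres`, team n1011, r = 1 strand, seat p17 GEN 3; row T-O7ss-P13
# FILE 4b — prover target (P3) of cc-typer-6's `Additive/QuadraticBranchOddStrictSelmer.lean`
# (p259634) on the 408 O7-ss ∩ (G)∧ss ∩ `e = 2` verbatim-extension cells)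

HONEST FRAMING (cell `b2b-bsdres`, run/shared/lean/b2b/bsd-rank1-residual/, verbatim in every
file): the goal of the cell is to DELETE the COMBINATION-SHAPED residual classes of the
Birch–Swinnerton-Dyer formula for ALL analytic-rank `≤ 1` elliptic curves over `ℚ` — "full BSD
formula for every rank `≤ 1` curve in class `C`" assembled STRICTLY from published theorems — so
that the rank-`≤ 1` remainder becomes exactly the CONSTRUCTION-SHAPED classes, which are TYPED
(missing-input `Prop`s), NOT attempted. This is not "finishing BSD". Team n1011: prove what is
provable now; shrink each hard class to its core with data; no claim beyond stated classes; research
routes; census output = EVIDENCE / conjecture items, never a Literature fact; RESIDUAL-MAP marks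
change only by signed lines. O7-ss stays OPEN, X4 CONSTRUCTION-SHAPED; nothing here is booked; no
label moves. Theorems only (NO definition, NO Literature fact, NO `_holds` of a conjecture): the typed
input `QuadraticBranchOddStrictSelmerBoundAt W p` of p259634 ("THEOREM-SHAPED, ASSEMBLY UNWRITTEN")
FOLLOWS from the two READING-shaped typed inputs (R1)/(R2) of FILE 4a
(`QuadraticBranchOddStrictSelmerReadings.lean`; NOTHING asserted there either) — everything between
them (Kobayashi's strict-minus structure, its `Λ`-dual, Lemma 9.1 at `n = 0`, Greenberg's Lemma 4.2,
the bottom layer = `Sel_str(W/ℚ)[p^∞]`, `W(ℚ_∞)[p^∞] = 0` from the surjectivity binder) is KERNEL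
(FILES 1–3 of the row). `#print axioms` standard.

## The two readings (flags `Kob03-Thm41-odd-eta-twist-reading`, `KO18-minus-eta-twist-reading`)

Frame (p259634): `p` odd, `p* = (−1)^{(p−1)/2} p`, `W/ℚ` globally minimal with `C • W^{(p*)} = V`
globally minimal, GOOD at `p`, `a_p(V) = 0`; `η = ω^{(p−1)/2}`; `K_n = ℚ(ζ_{p^{n+1}})`,
`K_∞ = ℚ(μ_{p^∞})`. DICTIONARY (cc-typer-6's route note; folklore prime-to-`p` descent + twist,
`W[p^∞] ≅ V[p^∞] ⊗ η`, `(V̂(K_{n,v}))^η = W(ℚ_{n,p}) ⊗ ℤ_p`, `V̂(ℚ_p)^η = 0`): Kobayashi's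
`X⁻(V/K_∞)^η` IS, as a `Λ`-module, the dual `X^{−,str}(W/ℚ_∞)` of the strict-minus Selmer group of
`W` over the cyclotomic `ℤ_p`-extension of `ℚ` with the model `ℚ_[p]` at `p` (FILE 2a/2b:
`StrictSignedSelmerDualData W κ ℚ_[p] γ (-1)`), `T = γ − 1` with `γ ↦ 1 + X` for a topological
generator matching the cyclotomic variable (`IsCyclotomicVariable`, Kobayashi §3 p. 5).

* (R1) `OddBranchStrictMinusDivisibilityAt W p` — READING of **Kobayashi 2003 Thm. 2.2 + Thm. 4.1**
  [§4 p. 8, verbatim: "Theorem 4.1. There exists an integer `n ≥ 0` such that … `Char(X⁻(E/K_∞)^η)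
  ⊇ (pⁿ X⁻¹ L_p⁻(E, η, X))` for `η ≠ 1`. If the `p`-adic representation `Gal(ℚ̄/ℚ) → GL_{ℤ_p}(T)`
  is surjective, then we can take `n = 0`"; Thm. 2.2 p. 5: `X^±` finitely generated torsion]:
  for every such `V` with `ρ_{V,p^∞}` onto and every `Lη` with the interpolation property of
  `L_p⁻(V, η, X)` (`IsQuadraticBranchMinusLFunction`), every strict-minus dual datum `D` of `W` is
  finitely generated `Λ`-torsion and its characteristic power series `g` divides `X⁻¹Lη`.
* (R2) `OddBranchStrictMinusNoFiniteSubmoduleAt W p` — READING of **Kitajima–Otsuki 2018 Main Thm.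
  1.3** [arXiv:1607.03612 p. 3, transcribed for the sign `+` in the tree fact
  `KitajimaOtsuki2018.mainThm13_plusSelmerDual_noFiniteSubmodule`; here the sign `−` with Def. 2.1's
  "`−1 ≤ m`" condition, p. 6]: for every such `V`, the strict-minus dual `X` has no non-trivial finite
  `Λ`-submodule (the `η`-part of a module without finite submodules has none).
Both are INPUTS exactly as p259634's; the difference is that they are READING-shaped (one printed
theorem each + the dictionary), not ASSEMBLY-shaped.

## The theorem

`quadraticBranchOddStrictSelmerBoundAt_of_readings : (R1) → (R2) → QuadraticBranchOddStrictSelmerBoundAt W p`.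
Proof = FILES 1–3: pick the cyclotomic `κ` with a generator matching the cyclotomic variable
(`exists_isCyclotomic_isTopGenerator_isCyclotomicVariable_holds`); `D := strictSignedSelmerDualData`
(FILE 2b, EXISTENCE); `W(ℚ_∞)[p^∞] = 0` from `ρ̄_{V,p}` onto (the binder at `m = 1`) transported to
`W` (p14's `hasSurjectiveModNGaloisRep_pow_iff_of_model_twist`), irreducibility
(`hasIrreducibleModPGaloisRep_of_hasSurjectiveModNGaloisRep`) and
`GaloisImage.fixedPoints_kerSubgroup_eq_bot_of_irreducible`; `Lη = X·L'` with `L'(0) = coeff₁ Lη`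
(cc-typer-6's PROVED `exists_eq_X_mul`); `g ∣ L'` gives `g(0) ∣ coeff₁ Lη ≠ 0`, so `g(0) ≠ 0` and
`v(g(0)) ≤ v(coeff₁ Lη)`; FILE 3's `finite_and_padicValNat_card_strictSelmerPInfty_le`.

References: [Kobayashi2003] Thm. 2.2 (p. 5), §4 + Thm. 4.1 (p. 8), §2 p. 4, Lemma 9.1 (p. 25);
[KitajimaOtsuki2018] Main Thm. 1.3, Def. 2.1 (arXiv:1607.03612 pp. 3, 6); [GreenbergLNM1716] §4
Lemma 4.2 (p. 102); cc-typer-6 p259634 / p261032.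
-/

noncomputable section

open scoped Classical MatrixGroups ModularForm

open CongruenceSubgroup Polynomial WeierstrassCurve Literature.NumberTheory.EllipticCurves
  Literature.NumberTheory.EllipticCurves.ModularForms
  Literature.NumberTheory.EllipticCurves.Kobayashi2003
  Literature.NumberTheory.EllipticCurves.Rank1Residual
  Literature.NumberTheory.EllipticCurves.Rank1Residual.Typed
  Literature.NumberTheory.GaloisRepresentations ZpExtension

namespace Summit.BirchSwinnertonDyer.Rank1Residual.Additive

/-! ## §2 `W(ℚ_∞)[p^∞] = 0` from the surjectivity binder -/

/-- **`W(ℚ_∞)[p^∞] = 0` on the route's cells** (the `hB` of FILES 1–3): `ρ̄_{V,p}` onto (the typed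
input's binder at `m = 1`) ⟹ `ρ̄_{W,p}` onto for the model `W` of the twist (p14's
`GaloisImage.hasSurjectiveModNGaloisRep_pow_iff_of_model_twist`, `p* ≠ 0`) ⟹ `W[p]` irreducible
(`hasIrreducibleModPGaloisRep_of_hasSurjectiveModNGaloisRep`) ⟹ no `p`-power torsion over ANY
`ℤ_p`-extension of `ℚ` (`GaloisImage.fixedPoints_kerSubgroup_eq_bot_of_irreducible`).
[cite: SilvermanAEC2009, X.5 Cor. 5.4] [cite: GreenbergLNM1716, §1 p. 62] -/
theorem fixedPoints_kerSubgroup_eq_bot_of_surj_twist (W : WeierstrassCurve ℚ) [W.IsElliptic]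
    (p : ℕ) [Fact p.Prime] {V : WeierstrassCurve ℚ} [V.IsElliptic] {C : VariableChange ℚ}
    (hC : C • W.quadraticTwist ((-1) ^ (p / 2) * p) = V)
    (hsurj : V.HasSurjectiveModNGaloisRep (p : ℕ)) (κ : ZpExtension ℚ p) :
    FixedPoints.addSubgroup κ.kerSubgroup (W.geomPrimaryTorsion p) = ⊥ := by
  have hd : ((-1 : ℚ) ^ (p / 2) * p) ≠ 0 :=
    mul_ne_zero (pow_ne_zero _ (by norm_num)) (by exact_mod_cast (Fact.out : p.Prime).ne_zero)
  have hW : W.HasSurjectiveModNGaloisRep (p ^ 1 : ℕ) := by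
    rw [← GaloisImage.hasSurjectiveModNGaloisRep_pow_iff_of_model_twist W p hd ⟨C, hC⟩ 1, pow_one]
    exact hsurj
  rw [pow_one] at hW
  haveI : NeZero (p : ℚ) := ⟨by exact_mod_cast (Fact.out : p.Prime).ne_zero⟩
  exact GaloisImage.fixedPoints_kerSubgroup_eq_bot_of_irreducible W p
    (hasIrreducibleModPGaloisRep_of_hasSurjectiveModNGaloisRep W p hW) κ

/-! ## §3 The typed input of p259634 from the two readings -/

/-- Valuations along a divisibility in `ℤ_p`: `a ∣ b`, `b ≠ 0` ⟹ `v(a) ≤ v(b)` in `ℚ_p`.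
[folklore] -/
theorem padicValuation_le_of_dvd {p : ℕ} [Fact p.Prime] {a b : ℤ_[p]} (h : a ∣ b) (hb : b ≠ 0) :
    ((a : ℚ_[p])).valuation ≤ ((b : ℚ_[p])).valuation := by
  obtain ⟨c, rfl⟩ := h
  have ha : a ≠ 0 := left_ne_zero_of_mul hb
  have hc : c ≠ 0 := right_ne_zero_of_mul hb
  rw [PadicInt.coe_mul, Padic.valuation_mul (PadicInt.coe_ne_zero.mpr ha) (PadicInt.coe_ne_zero.mpr hc)]
  linarith [PadicInt.valuation_coe_nonneg (x := c)]

/-- **(P3) — `QuadraticBranchOddStrictSelmerBoundAt W p` IS A THEOREM modulo the two readings.**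
For `W/ℚ` globally minimal and `p` prime: (R1) ∧ (R2) ⟹ p259634's typed input — for every good
`a_p = 0` twist `V` with `ρ_{V,p^∞}` onto, newform `f`, period ratio `ϖ`, and `Lη` interpolating
`L_p⁻(V, η, X)` with `coeff₁ Lη ≠ 0`: **`Sel_str(W/ℚ)[p^∞]` is finite and
`ord_p #Sel_str(W/ℚ)[p^∞] ≤ v_p(coeff₁ Lη)`.** Chain: cyclotomic `κ` with a generator matching the
cyclotomic variable; the strict-minus dual datum `D` EXISTS (FILE 2b); (R1): f.g. torsion and
`g ∣ L'` (`Lη = X·L'`, `L'(0) = coeff₁ Lη` by `exists_eq_X_mul`) ⟹ `g(0) ≠ 0`, `v(g(0)) ≤ v(coeff₁ Lη)`;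
(R2): no finite submodule; §2: `W(ℚ_∞)[p^∞] = 0`; FILE 3:
`finite_and_padicValNat_card_strictSelmerPInfty_le`. With cc-typer-6's PROVED consumer
`bsdp_of_oddStrictSelmerBound_of_unit` (p261032) and p01's (P4), the verbatim-extension cells get
`BSD(W, p)` from (R1) + (R2) + certificates (i)(ii). O7-ss stays OPEN; nothing booked.
[cite: Kobayashi2003, Thm. 4.1 (p. 8), Thm. 2.2 (p. 5), Lemma 9.1 (p. 25), §2 p. 4]
[cite: KitajimaOtsuki2018, Main Thm. 1.3 (arXiv:1607.03612 p. 3)] [cite: GreenbergLNM1716, §4 Lemma 4.2 (p. 102)] -/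
theorem quadraticBranchOddStrictSelmerBoundAt_of_readings (W : WeierstrassCurve ℚ) [W.IsElliptic]
    [W.IsGloballyMinimal] (p : ℕ) [Fact p.Prime]
    (h1 : OddBranchStrictMinusDivisibilityAt W p) (h2 : OddBranchStrictMinusNoFiniteSubmoduleAt W p) :
    QuadraticBranchOddStrictSelmerBoundAt W p := by
  intro V _ _ C N _ f hp2 hC hgood hap hsurj hf ϖ hϖ Lη hL hc1
  -- the cyclotomic `ℤ_p`-extension with a generator matching the cyclotomic variable
  obtain ⟨κ, hκ, γ, hγ, hγ'⟩ := exists_isCyclotomic_isTopGenerator_isCyclotomicVariable_holds p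
  -- the strict-minus dual datum EXISTS
  let D : StrictSignedSelmerDualData W κ ℚ_[p] γ (-1) := strictSignedSelmerDualData W κ ℚ_[p] (-1) hγ
  -- (R1): finitely generated torsion, `g ∣ L'`
  obtain ⟨hfinD, htorD, hdvd⟩ := h1 V C hp2 hC hgood hap hsurj hf ϖ hϖ Lη hL κ γ hκ hγ hγ' D
  haveI := hfinD
  obtain ⟨g, hg⟩ := (charIdeal_isPrincipal_holds p D.X).principal
  have hg' : D.charIdeal = Ideal.span {g} := hg
  obtain ⟨L', hL', hL'0⟩ := hL.exists_eq_X_mul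
  have hgL' : g ∣ L' := hdvd g L' hg' hL'
  -- `g(0) ∣ L'(0) = coeff₁ Lη ≠ 0`
  have hg0dvd : PowerSeries.constantCoeff g ∣ PowerSeries.coeff 1 Lη := by
    rw [← hL'0]; exact map_dvd PowerSeries.constantCoeff hgL'
  have hg0 : PowerSeries.constantCoeff g ≠ 0 := fun h0 ↦ hc1 (by
    rw [h0] at hg0dvd; exact zero_dvd_iff.mp hg0dvd)
  -- (R2): no finite submodule; §2: no `p`-torsion over `ℚ_∞`
  have hnf : ∀ M : Submodule (IwasawaAlgebra p) D.X, Finite M → M = ⊥ :=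
    h2 V C hp2 hC hgood hap κ γ hκ hγ D hfinD htorD
  have hB : FixedPoints.addSubgroup κ.kerSubgroup (W.geomPrimaryTorsion p) = ⊥ :=
    fixedPoints_kerSubgroup_eq_bot_of_surj_twist W p hC (by simpa using hsurj 1) κ
  -- FILE 3
  obtain ⟨hfin, hle⟩ :=
    StrictSignedControlZero.finite_and_padicValNat_card_strictSelmerPInfty_le W hγ D htorD hB hnf
      hg' hg0
  exact ⟨hfin, hle.trans (padicValuation_le_of_dvd hg0dvd hc1)⟩

/-- **The image-free CONDITIONAL twin — `QuadraticBranchOddStrictSelmerBoundOfPlusMCAt W p` IS A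
THEOREM modulo (R3) + (R2), GIVEN that `W[p]` is irreducible** (`hirr`: automatic on the class served,
X4 — all 515 `SubGss` cells; it supplies `W(ℚ_∞)[p^∞] = 0`, the `hB` of Kobayashi's Lemma 9.1,
which the image-free typed input has no binder for: `GaloisImage.fixedPoints_kerSubgroup_eq_bot_of_
irreducible`). Same chain as `quadraticBranchOddStrictSelmerBoundAt_of_readings` with (R3) (even MC
(C1_η) + Thm. 7.4) in place of (R1) (Thm. 4.1, `n = 0`). For the 107 non-surjective twins of
cc-typer-6's census (normaliser-of-non-split-Cartan images: irreducible); consumer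
`bsdp_of_oddStrictSelmerBoundOfPlusMC_of_unit` (p261032). Nothing booked; O7-ss stays OPEN.
[cite: Kobayashi2003, Thm. 7.4 (p. 13), Thm. 2.2 (p. 5), Lemma 9.1 (p. 25), §2 p. 4]
[cite: KitajimaOtsuki2018, Main Thm. 1.3 (arXiv:1607.03612 p. 3)] [cite: GreenbergLNM1716, §4 Lemma 4.2 (p. 102)] -/
theorem quadraticBranchOddStrictSelmerBoundOfPlusMCAt_of_readings (W : WeierstrassCurve ℚ)
    [W.IsElliptic] [W.IsGloballyMinimal] (p : ℕ) [Fact p.Prime]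
    (hirr : W.HasIrreducibleModPGaloisRep p)
    (h3 : OddBranchStrictMinusDivisibilityOfPlusMCAt W p)
    (h2 : OddBranchStrictMinusNoFiniteSubmoduleAt W p) :
    QuadraticBranchOddStrictSelmerBoundOfPlusMCAt W p := by
  intro V _ _ C N _ f hp2 hC hgood hap hMC hf ϖ hϖ Lη hL hc1
  obtain ⟨κ, hκ, γ, hγ, hγ'⟩ := exists_isCyclotomic_isTopGenerator_isCyclotomicVariable_holds p
  let D : StrictSignedSelmerDualData W κ ℚ_[p] γ (-1) := strictSignedSelmerDualData W κ ℚ_[p] (-1) hγ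
  obtain ⟨hfinD, htorD, hdvd⟩ := h3 V C hp2 hC hgood hap hMC hf ϖ hϖ Lη hL κ γ hκ hγ hγ' D
  haveI := hfinD
  obtain ⟨g, hg⟩ := (charIdeal_isPrincipal_holds p D.X).principal
  have hg' : D.charIdeal = Ideal.span {g} := hg
  obtain ⟨L', hL', hL'0⟩ := hL.exists_eq_X_mul
  have hgL' : g ∣ L' := hdvd g L' hg' hL'
  have hg0dvd : PowerSeries.constantCoeff g ∣ PowerSeries.coeff 1 Lη := by
    rw [← hL'0]; exact map_dvd PowerSeries.constantCoeff hgL'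
  have hg0 : PowerSeries.constantCoeff g ≠ 0 := fun h0 ↦ hc1 (by
    rw [h0] at hg0dvd; exact zero_dvd_iff.mp hg0dvd)
  have hnf : ∀ M : Submodule (IwasawaAlgebra p) D.X, Finite M → M = ⊥ :=
    h2 V C hp2 hC hgood hap κ γ hκ hγ D hfinD htorD
  have hB : FixedPoints.addSubgroup κ.kerSubgroup (W.geomPrimaryTorsion p) = ⊥ :=
    GaloisImage.fixedPoints_kerSubgroup_eq_bot_of_irreducible W p hirr κ
  obtain ⟨hfin, hle⟩ :=
    StrictSignedControlZero.finite_and_padicValNat_card_strictSelmerPInfty_le W hγ D htorD hB hnf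
      hg' hg0
  exact ⟨hfin, hle.trans (padicValuation_le_of_dvd hg0dvd hc1)⟩

/-! ## §4 End to end on the certified cells: (R1)/(R3) + (R2) + certificates (i)(ii) ⟹ `BSD(W, p)` -/

section EndToEnd

variable {W : WeierstrassCurve ℚ} [W.IsElliptic] [W.IsGloballyMinimal] {p : ℕ} [Fact p.Prime]

/-- **END TO END on the verbatim-extension cells (`ρ_{V,p^∞}` onto): `BSD(W, p)` from the two
READINGS (R1) (Kobayashi Thm. 4.1 odd-`η`, `n = 0`) + (R2) (Kitajima–Otsuki sign `−`), the two
PER-PAIR CERTIFICATES (i) `coeff₁ L_p⁻(V, η, X) ∈ ℤ_p^×` and (ii) `ord_p #Ш_an(W) = 0`, `r_an(W) = 1`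
and GZK** — cc-typer-6's PROVED consumer `bsdp_of_oddStrictSelmerBound_of_unit` (p261032) fed with
`quadraticBranchOddStrictSelmerBoundAt_of_readings` (this file) and p01's PROVED (P4)
`StrictSha.strictSelmerDominatesShaAt_holds` (p01, T-O7ss-P4): NO assembly-shaped input and NO
elementary-lemma input remain; NO `p`-adic height, NO Gross–Zagier formula on the branch. The class
served (O7-ss ∩ (G)∧ss ∩ `e = 2`, 408 cells of record) stays OPEN: (R1)/(R2) are readings, (i)/(ii)
per-pair instrument data; nothing is booked. [cite: Kobayashi2003, Thm. 4.1 (p. 8), §2 p. 4, Lemma 9.1 (p. 25)]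
[cite: KitajimaOtsuki2018, Main Thm. 1.3 (arXiv:1607.03612 p. 3)] [cite: GreenbergLNM1716, §4 Lemma 4.2 (p. 102)] -/
theorem bsdp_of_oddBranchReadings_of_unit (hGZK : rank_eq_analyticRank_of_analyticRank_le_one)
    (h1 : OddBranchStrictMinusDivisibilityAt W p) (h2 : OddBranchStrictMinusNoFiniteSubmoduleAt W p)
    {V : WeierstrassCurve ℚ} [V.IsElliptic] [V.IsGloballyMinimal] {C : VariableChange ℚ}
    {N : ℕ} [NeZero N] {f : CuspForm (Gamma0 N) 2} {ϖ : ℚ} {Lη : IwasawaAlgebra p}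
    (hp : p ≠ 2) (hC : C • W.quadraticTwist ((-1) ^ (p / 2) * p) = V)
    (hgood : V.HasGoodReductionAtPrime p) (hap : V.frobeniusTrace p = 0)
    (hsurj : ∀ m : ℕ, V.HasSurjectiveModNGaloisRep (p ^ m : ℕ)) (hf : IsNewformOf V f)
    (hϖ : if Even (p / 2) then (ϖ : ℝ) * V.realPeriodRat = plusPeriod f
        else (ϖ : ℝ) * V.imaginaryPeriodRat = minusPeriod f)
    (hL : IsQuadraticBranchMinusLFunction f p ϖ Lη) (hunit : IsUnit (PowerSeries.coeff 1 Lη))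
    (hsha : ∃ q : ℚ, shaAn W = (q : ℂ) ∧ padicValRat p q = 0) (hr : W.analyticRank = 1) :
    BSDp W p :=
  bsdp_of_oddStrictSelmerBound_of_unit (W := W) (p := p) hGZK
    (quadraticBranchOddStrictSelmerBoundAt_of_readings W p h1 h2)
    (StrictSha.strictSelmerDominatesShaAt_holds W p) hp hC hgood hap hsurj hf hϖ hL hunit hsha hr

/-- **END TO END on the conditional cells (no image hypothesis; `W[p]` irreducible): `BSD(W, p)`
from (R3) ((C1_η) + Thm. 7.4) + (R2) + certificates (i)(ii), `r_an(W) = 1`, GZK** — cc-typer-6's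
`bsdp_of_oddStrictSelmerBoundOfPlusMC_of_unit` fed with `quadraticBranchOddStrictSelmerBoundOfPlusMCAt_
of_readings` and p01's (P4). Conditional on the sibling's typed (C1_η) (CONJECTURE IN PRINT) through
(R3); NOT an O10 route. Nothing booked. [cite: Kobayashi2003, Thm. 7.4 (p. 13), §2 p. 4, Lemma 9.1 (p. 25)]
[cite: KitajimaOtsuki2018, Main Thm. 1.3 (arXiv:1607.03612 p. 3)] -/
theorem bsdp_of_oddBranchPlusMCReadings_of_unit (hGZK : rank_eq_analyticRank_of_analyticRank_le_one)
    (hirr : W.HasIrreducibleModPGaloisRep p)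
    (h3 : OddBranchStrictMinusDivisibilityOfPlusMCAt W p) (h2 : OddBranchStrictMinusNoFiniteSubmoduleAt W p)
    {V : WeierstrassCurve ℚ} [V.IsElliptic] [V.IsGloballyMinimal] {C : VariableChange ℚ}
    {N : ℕ} [NeZero N] {f : CuspForm (Gamma0 N) 2} {ϖ : ℚ} {Lη : IwasawaAlgebra p}
    (hp : p ≠ 2) (hC : C • W.quadraticTwist ((-1) ^ (p / 2) * p) = V)
    (hgood : V.HasGoodReductionAtPrime p) (hap : V.frobeniusTrace p = 0)
    (hMC : QuadraticBranchPlusMainConjectureAt V p) (hf : IsNewformOf V f)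
    (hϖ : if Even (p / 2) then (ϖ : ℝ) * V.realPeriodRat = plusPeriod f
        else (ϖ : ℝ) * V.imaginaryPeriodRat = minusPeriod f)
    (hL : IsQuadraticBranchMinusLFunction f p ϖ Lη) (hunit : IsUnit (PowerSeries.coeff 1 Lη))
    (hsha : ∃ q : ℚ, shaAn W = (q : ℂ) ∧ padicValRat p q = 0) (hr : W.analyticRank = 1) :
    BSDp W p :=
  bsdp_of_oddStrictSelmerBoundOfPlusMC_of_unit (W := W) (p := p) hGZK
    (quadraticBranchOddStrictSelmerBoundOfPlusMCAt_of_readings W p hirr h3 h2)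
    (StrictSha.strictSelmerDominatesShaAt_holds W p) hp hC hgood hap hMC hf hϖ hL hunit hsha hr

end EndToEnd

end Summit.BirchSwinnertonDyer.Rank1Residual.Additive

end
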